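import Summits.BirchSwinnertonDyer.BirchSwinnertonDyer.Theorems.GenusKolyvaginAtTwoGenusPrimitiveSupplyAtTwoTwistLemma211Transverse
import Summits.BirchSwinnertonDyer.BirchSwinnertonDyer.Theorems.GenusKolyvaginAtTwoGenusPrimitiveSupplyAtTwoTwistSelmerTransferUp
import Summits.BirchSwinnertonDyer.BirchSwinnertonDyer.Theorems.GenusKolyvaginAtTwoGenusPrimitiveSupplyAtTwoTwistLocalConditionFrame
import Summits.BirchSwinnertonDyer.BirchSwinnertonDyer.Theorems.GenusKolyvaginAtTwoKramerParityOfFrame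
import HarnessLib

/-!
# Route `GenusKolyvaginAtTwo`, crux #2 `GenusPrimitiveSupplyAtTwo` (stmt-BirchSwinnertonDyer-22136):
# Mazur–Rubin Cor. 3.4 (i) with a single FINITE `T`-place for the CANONICAL identification — UP and the dichotomy WITHOUT
# Kramer parity as a named fact and WITHOUT the `ρ̄_{W,2}`-onto hypothesis (every number field)

Width seat `bsd-line-gk2-p4` g12 (cell `bsd-f1-sign2`), the finite-place companion of `…ArchimedeanFrame` (§70–§72, one REAL `T`-place);
sequel of gk2-p5's files 5/9 (`…TwistSelmerTransferDown`: DOWN; `…TwistLemma211Transverse`: Lemma 2.10 (i) + Lemma 2.11 for the canonical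
identification) and `…TwistSelmerTransferUp` (UP with the parity DISPLAYED, `natCard_selmerGroup_twist_eq_mul_two_of_local_of_isSquare`), and of
the KramerParity series part 9 (`GenusKolyKramer.isSquare_card_selmerGroup_mul_of_frame`) with `…TwistLocalConditionFrame` (the canonical
identification is FRAMED). THEOREMS ONLY (no definition, no named fact, no `sorry`); helper `--supports stmt-BirchSwinnertonDyer-22136`;
no item is closed; BSD is not proved by any of this.

WHAT.
* §75 `transport_twist_agree_off_inr` — the finite-`T`-place menu (split | odd good both | odd silent both; every infinite place split or
  `H¹ = 0` for both) gives `φ_* 𝓚_{Wd,v} = 𝓚_{W,v}` at every place `v ≠ v₀` (the block proved inline in gk2-p5's files, exported);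
* §76 `exists_intertwining_hsplit_and_transverse_frame` — file 9's package (split agreement + Lemma 2.11 transversality at ramified good odd
  places) PLUS the frame datum of the SAME `φ`;
* §77 `natCard_selmerGroup_twist_eq_mul_two_of_local_of_frame` (UP for a framed `φ`, mod {PT, Tate χ}; parity from part 9 — no `hKP`, no
  `hsurj`), `natCard_selmerGroup_twist_shift_of_local_of_frame` (dichotomy);
* §78 **`natCard_selmerGroup_twist_shift_of_local_frame`** — **Cor. 3.4 (i) with `T = {v₀}` (`v₀ ∤ 2` good, ramified in `K(√d)`,
  `#W(K_{v₀})[2] = 2`) UNCONDITIONAL**: `#Sel₂(Wd)·2 = #Sel₂(W)` or `#Sel₂(Wd) = #Sel₂(W)·2`, for EVERY elliptic `W` over a number field and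
  every twist model, the finite/infinite places on the menus — PT, Tate χ and Kramer's congruence fed by tree theorems, no image hypothesis.

References: [MazurRubin2010] Thm. 2.7, Remark 2.4, Lemmas 2.9–2.11, Prop. 3.3, Cor. 3.4 (i); [Kramer1981] Thm. 1, Prop. 7;
[KlagsbrunMazurRubin2013] Thm. 3.9, Lemma 5.2; [MilneADT2006] I Thm. 2.8, Lemma 3.3, Thm. 4.10.
-/

set_option linter.dupNamespace false -- tree convention: `Summit.BirchSwinnertonDyer.BirchSwinnertonDyer.Theorems` (summit = sub-problem)
set_option autoImplicit false

noncomputable section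

open scoped Classical ContRepresentation

namespace Summit.BirchSwinnertonDyer.BirchSwinnertonDyer.Theorems.GenusKolyTwistLocal

open WeierstrassCurve Field NumberField IsDedekindDomain Function
open Literature.NumberTheory.EllipticCurves Literature.NumberTheory.GaloisRepresentations
open Literature.NumberTheory.EllipticCurves.DokchitserDokchitser2012 (T xT)
open Literature.NumberTheory.GaloisRepresentations.IsNonarchimedeanLocalField
open Literature.NumberTheory.GaloisRepresentations.DiscreteGaloisModule (SelmerStructure)
open Literature.NumberTheory.GaloisCohomology
open Summit.BirchSwinnertonDyer.Rank1Residual.X11b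
open Summit.BirchSwinnertonDyer.Rank1Residual.X11b.CongruentTransfer
open Summit.BirchSwinnertonDyer.BirchSwinnertonDyer.Theorems.SchneiderFreeAdditiveX3.PoitouTateReduction
  (poitouTate_selmerStructure_duality_real_holds)

variable {K : Type} [Field K] [NumberField K] (W Wd : WeierstrassCurve K) [W.IsElliptic] [Wd.IsElliptic]

/-! ## §75 The finite-`T`-place menu: agreement off `v₀` -/

/-- **Agreement of the transported Kummer structure off the `T`-place `v₀`, from the place menus** (the block proved inline in gk2-p5's
`natCard_selmerGroup_twist_mul_two_eq_of_local` / `…_of_local_of_isSquare`, exported): for inverse intertwinings `φ, ψ` agreeing with the Kummer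
conditions at split places, `𝓐 = φ_* 𝓚_{Wd}`, and every finite `v ≠ v₀` split ∨ (odd ∧ good for both) ∨ (odd ∧ silent for both), every
infinite place split ∨ (`H¹ = 0` for both): `𝓐_v = 𝓚_{W,v}` for all `v ≠ v₀`. [cite: MazurRubin2010, Lemma 2.10 (i), (ii), (iv)] -/
theorem transport_twist_agree_off_inr {d : K}
    (φ : (Wd.torsionGaloisModule ((2 : ℕ) : ℤ)).toContRepresentation →ⁱL
      (W.torsionGaloisModule ((2 : ℕ) : ℤ)).toContRepresentation)
    (ψ : (W.torsionGaloisModule ((2 : ℕ) : ℤ)).toContRepresentation →ⁱL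
      (Wd.torsionGaloisModule ((2 : ℕ) : ℤ)).toContRepresentation)
    (hφψ : ∀ b, φ (ψ b) = b)
    (hsplit : ∀ (E : Type) [Field E] [Algebra K E], (∃ s : E, s ^ 2 = algebraMap K E d) →
      (Wd.kummerLocalConditionAt ((2 : ℕ) : ℤ) E).map (galoisCohomology.map (φ.restrictField E) 1) =
        W.kummerLocalConditionAt ((2 : ℕ) : ℤ) E)
    (𝓐 : SelmerStructure (W.torsionGaloisModule ((2 : ℕ) : ℤ)))
    (h𝓐 : ∀ v, 𝓐 v = (Wd.kummerSelmerStructure ((2 : ℕ) : ℤ) v).map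
      (galoisCohomology.map (φ.restrictField (Place.Completion v)) 1))
    (v₀ : HeightOneSpectrum (𝓞 K))
    (hfin : ∀ v : HeightOneSpectrum (𝓞 K), v ≠ v₀ →
      (∃ s : v.adicCompletion K, s ^ 2 = algebraMap K (v.adicCompletion K) d) ∨
      (((2 : ℕ) : 𝓞 K) ∉ v.asIdeal ∧ W.HasGoodReductionAt v ∧ Wd.HasGoodReductionAt v) ∨
      (((2 : ℕ) : 𝓞 K) ∉ v.asIdeal ∧
        Nat.card (nsmulAddMonoidHom 2 : (W.baseChange (v.adicCompletion K)).toAffine.Point →+ _).ker = 1 ∧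
        Nat.card (nsmulAddMonoidHom 2 : (Wd.baseChange (v.adicCompletion K)).toAffine.Point →+ _).ker = 1))
    (hinf : ∀ w : InfinitePlace K,
      (∃ s : w.Completion, s ^ 2 = algebraMap K w.Completion d) ∨
      ((∀ x : galoisCohomology (W.localGaloisModule w.Completion) 1, x = 0) ∧
        (∀ x : galoisCohomology (Wd.localGaloisModule w.Completion) 1, x = 0))) :
    ∀ v : Place K, v ≠ Sum.inr v₀ → 𝓐 v = W.kummerSelmerStructure ((2 : ℕ) : ℤ) v := by
  haveI : Fact (Nat.Prime 2) := ⟨Nat.prime_two⟩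
  rintro (w | v) hv
  · rcases hinf w with ⟨s, hs⟩ | ⟨hW, hWd⟩
    · rw [h𝓐, kummerSelmerStructure_apply, kummerSelmerStructure_apply]
      exact hsplit (Place.Completion (Sum.inl w)) ⟨s, hs⟩
    · rw [h𝓐, kummerSelmerStructure_apply, kummerSelmerStructure_apply]
      exact map_kummerLocalConditionAt_eq_of_eq_top W Wd ((2 : ℕ) : ℤ) (Place.Completion (Sum.inl w)) φ ψ hφψ
        (kummerLocalConditionAt_eq_top_of_forall_eq_zero Wd _ _ hWd)
        (kummerLocalConditionAt_eq_top_of_forall_eq_zero W _ _ hW)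
  · have hvv₀ : v ≠ v₀ := fun h ↦ hv (by rw [h])
    rcases hfin v hvv₀ with ⟨s, hs⟩ | ⟨h2v, hvW, hvWd⟩ | ⟨h2v, h1W, h1Wd⟩
    · rw [h𝓐, kummerSelmerStructure_apply, kummerSelmerStructure_apply]
      exact hsplit (Place.Completion (Sum.inr v)) ⟨s, hs⟩
    · exact transport_kummer_inr_eq_of_good W Wd 2 φ ψ hφψ 𝓐 h𝓐 h2v hvW hvWd
    · rw [h𝓐, kummerSelmerStructure_apply, kummerSelmerStructure_apply]
      exact map_kummerLocalConditionAt_adicCompletion_eq_of_natCard_ker_eq_one W Wd v two_ne_zero h2v h1W h1Wd φ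

/-! ## §76 The canonical identification: split agreement, Lemma 2.11 AND the frame datum -/

/-- **Lemma 2.10 (i), LEMMA 2.11 and the FRAME DATUM for ONE identification `E^{(d)}[2] ≅ E[2]`** — gk2-p5's
`exists_intertwining_hsplit_and_transverse` VERBATIM (same proof on top of `exists_addEquiv_geomTorsion_two_localSquare_signed_frame`) plus
`∃ π A, (∀ j, φ T'_j = T_{πj}) ∧ (∀ i j, x'_i − x'_j = A·(x_{πi} − x_{πj}))` for the same `φ`.
[cite: MazurRubin2010, Remark 2.4, Lemmas 2.10 (i), 2.11] [cite: KlagsbrunMazurRubin2013, Lemma 5.2] [cite: SilvermanAEC2009, X.5 Cor. 5.4] -/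
theorem exists_intertwining_hsplit_and_transverse_frame {d : K} (hd : d ≠ 0) {C : VariableChange K}
    (hWd : C • W.quadraticTwist d = Wd) :
    ∃ (φ : (Wd.torsionGaloisModule ((2 : ℕ) : ℤ)).toContRepresentation →ⁱL
        (W.torsionGaloisModule ((2 : ℕ) : ℤ)).toContRepresentation)
      (φ' : (W.torsionGaloisModule ((2 : ℕ) : ℤ)).toContRepresentation →ⁱL
        (Wd.torsionGaloisModule ((2 : ℕ) : ℤ)).toContRepresentation),
      (∀ a, φ' (φ a) = a) ∧ (∀ b, φ (φ' b) = b) ∧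
      (∀ (E : Type) [Field E] [Algebra K E], (∃ s : E, s ^ 2 = algebraMap K E d) →
        (Wd.kummerLocalConditionAt ((2 : ℕ) : ℤ) E).map (galoisCohomology.map (φ.restrictField E) 1) =
          W.kummerLocalConditionAt ((2 : ℕ) : ℤ) E) ∧
      (∀ (v : HeightOneSpectrum (𝓞 K)), W.HasGoodReductionAt v → ((2 : ℕ) : 𝓞 K) ∉ v.asIdeal →
        closureEmb (K := K) (v.adicCompletion K) (geomSqrt d) ∉ maxUnramified (v.adicCompletion K) →
        (Wd.kummerLocalConditionAt ((2 : ℕ) : ℤ) (v.adicCompletion K)).map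
            (galoisCohomology.map (φ.restrictField (v.adicCompletion K)) 1) ⊓
          W.kummerLocalConditionAt ((2 : ℕ) : ℤ) (v.adicCompletion K) = ⊥) ∧
      ∃ (π : Fin 3 → Fin 3) (A : K),
        (∀ j, (show (Wd.torsionGaloisModule 2).toContRepresentation →ⁱL (W.torsionGaloisModule 2).toContRepresentation
          from φ) (T Wd (two_ne_zero (α := K)) j) = T W (two_ne_zero (α := K)) (π j)) ∧
        (∀ i j, xT Wd (two_ne_zero (α := K)) i - xT Wd (two_ne_zero (α := K)) j
          = algebraMap K (AlgebraicClosure K) A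
            * (xT W (two_ne_zero (α := K)) (π i) - xT W (two_ne_zero (α := K)) (π j))) := by
  haveI : NeZero (2 : K) := ⟨two_ne_zero⟩
  obtain ⟨ψ, hψ, ⟨π, A, hπ, hA⟩, hloc⟩ := exists_addEquiv_geomTorsion_two_localSquare_signed_frame W hd hWd
  have hψ' : ∀ (σ : absoluteGaloisGroup K) (Q : geomTorsion W (2 : ℤ)),
      ψ.symm (σ • Q) = σ • ψ.symm Q := fun σ Q ↦
    ψ.injective (by rw [hψ, ψ.apply_symm_apply, ψ.apply_symm_apply])
  let φ : (Wd.torsionGaloisModule ((2 : ℕ) : ℤ)).toContRepresentation →ⁱL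
      (W.torsionGaloisModule ((2 : ℕ) : ℤ)).toContRepresentation :=
    { toContinuousLinearMap := ⟨ψ.toAddMonoidHom.toIntLinearMap, continuous_of_discreteTopology⟩
      isIntertwining' := fun σ ↦ by
        ext P
        exact congrArg Subtype.val (hψ σ P) }
  let φ' : (W.torsionGaloisModule ((2 : ℕ) : ℤ)).toContRepresentation →ⁱL
      (Wd.torsionGaloisModule ((2 : ℕ) : ℤ)).toContRepresentation :=
    { toContinuousLinearMap := ⟨ψ.symm.toAddMonoidHom.toIntLinearMap, continuous_of_discreteTopology⟩
      isIntertwining' := fun σ ↦ by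
        ext Q
        exact congrArg Subtype.val (hψ' σ Q) }
  have hφ : ∀ a, φ a = ψ a := fun _ ↦ rfl
  have hφ' : ∀ b, φ' b = ψ.symm b := fun _ ↦ rfl
  -- one inclusion of Lemma 2.10 (i), for an arbitrary Γ_E-equivariant intertwined local datum
  have key : ∀ (E : Type) [Field E] [Algebra K E] {X Y : WeierstrassCurve K}
      (χ : (X.torsionGaloisModule ((2 : ℕ) : ℤ)).toContRepresentation →ⁱL
        (Y.torsionGaloisModule ((2 : ℕ) : ℤ)).toContRepresentation) (η : localPoints X E ≃+ localPoints Y E),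
      (∀ (σ : absoluteGaloisGroup E) (Q : localPoints X E), η (σ • Q) = σ • η Q) →
      (∀ t : geomTorsion X ((2 : ℕ) : ℤ),
        pointsMap Y E (χ t : geomPoints Y) = η (pointsMap X E (t : geomPoints X))) →
      ∀ x ∈ X.kummerLocalConditionAt ((2 : ℕ) : ℤ) E,
        galoisCohomology.map (χ.restrictField E) 1 x ∈ Y.kummerLocalConditionAt ((2 : ℕ) : ℤ) E := by
    intro E _ _ X Y χ η hη hχ x hx
    obtain ⟨f, rfl⟩ := oneCocycleClass_surjective
      (DiscreteGaloisModule.toTopRep (GaloisRep.restrictField E (X.torsionGaloisModule ((2 : ℕ) : ℤ)))) x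
    rw [mem_kummerLocalConditionAt_iff, map_torsionPointsMapIntertwining_oneCocycleClass] at hx
    obtain ⟨Q, hQ⟩ := (oneCocycleClass_eq_zero_iff _ _).mp hx
    have hQ' : ∀ σ : absoluteGaloisGroup E,
        pointsMap X E ((f.1 σ : geomTorsion X ((2 : ℕ) : ℤ)) : geomPoints X) = σ • Q - Q := hQ
    rw [galoisCohomology.map_one_oneCocycleClass, mem_kummerLocalConditionAt_iff,
      map_torsionPointsMapIntertwining_oneCocycleClass]
    refine (oneCocycleClass_eq_zero_iff _ _).mpr ⟨η Q, fun σ ↦ ?_⟩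
    change pointsMap Y E ((χ (f.1 σ) : geomTorsion Y ((2 : ℕ) : ℤ)) : geomPoints Y) = σ • η Q - η Q
    rw [hχ, hQ', map_sub, hη]
  refine ⟨φ, φ', fun a ↦ ψ.symm_apply_apply a, fun b ↦ ψ.apply_symm_apply b, fun E _ _ hsq ↦ ?_,
    fun v hv h2v hram ↦ ?_, π, A, fun j ↦ hπ j, hA⟩
  · -- (i) split places: every σ fixes ι(√d), θ_E is Γ_E-equivariant
    obtain ⟨s, hs⟩ := hsq
    obtain ⟨θ, hfix, -, -, hsquare⟩ := hloc E
    have hθ : ∀ (σ : absoluteGaloisGroup E) (Q : localPoints Wd E), θ (σ • Q) = σ • θ Q :=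
      fun σ Q ↦ hfix σ (smul_closureEmb_geomSqrt_eq E hs σ) Q
    have hθ' : ∀ (σ : absoluteGaloisGroup E) (Q : localPoints W E), θ.symm (σ • Q) = σ • θ.symm Q :=
      symm_equivariant θ hθ
    have hsquare' : ∀ t : geomTorsion W ((2 : ℕ) : ℤ),
        pointsMap Wd E (ψ.symm t : geomPoints Wd) = θ.symm (pointsMap W E (t : geomPoints W)) := fun t ↦ by
      apply θ.injective
      rw [← hsquare (ψ.symm t), ψ.apply_symm_apply, θ.apply_symm_apply]
    apply le_antisymm
    · rw [AddSubgroup.map_le_iff_le_comap]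
      intro x hx
      exact key E φ θ hθ (fun t ↦ by rw [hφ]; exact hsquare t) x hx
    · intro y hy
      refine ⟨galoisCohomology.map (φ'.restrictField E) 1 y,
        key E φ' θ.symm hθ' (fun t ↦ by rw [hφ']; exact hsquare' t) y hy, ?_⟩
      obtain ⟨f, rfl⟩ := oneCocycleClass_surjective
        (DiscreteGaloisModule.toTopRep (GaloisRep.restrictField E (W.torsionGaloisModule ((2 : ℕ) : ℤ)))) y
      rw [galoisCohomology.map_one_oneCocycleClass, galoisCohomology.map_one_oneCocycleClass]
      congr 1
      apply Subtype.ext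
      ext g : 1
      rw [contOneCocycles.pullback_apply, contOneCocycles.pullback_apply]
      exact ψ.apply_symm_apply (f.1 g)
  · -- (ii) LEMMA 2.11 at a ramified good odd place (gk2-p5's argument, verbatim)
    haveI : CharZero (v.adicCompletion K) :=
      Literature.NumberTheory.GaloisRepresentations.charZero_adicCompletion v
    have hn : ((2 : ℕ) : ℤ) ≠ 0 := by norm_num
    obtain ⟨θ, -, hneg, -, hsquare⟩ := hloc (v.adicCompletion K)
    have hx2 : (closureEmb (K := K) (v.adicCompletion K) (geomSqrt d)) ^ 2 =
        algebraMap K (AlgebraicClosure (v.adicCompletion K)) d := by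
      rw [← map_pow, geomSqrt_sq, AlgHom.commutes]
    obtain ⟨τ₀, hτ₀I, hτ₀⟩ := exists_mem_absInertia_smul_eq_neg v hx2 hram
    rw [eq_bot_iff]
    rintro c hc
    obtain ⟨⟨c', hc', rfl⟩, hcW⟩ := AddSubgroup.mem_inf.mp hc
    obtain ⟨T, hT2, rfl⟩ := exists_twoTorsion_localKummerMap_eq W Wd v hd hWd hv h2v hram hc'
    have hur := KummerPT.kummerSelmerStructure_inr_eq_unramifiedSubgroup W 2 1 h2v hv
    rw [pow_one, kummerSelmerStructure_apply] at hur
    change W.kummerLocalConditionAt ((2 : ℕ) : ℤ) (v.adicCompletion K) = _ at hur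
    rw [hur] at hcW
    set Q := Wd.localZSMulRoot (v.adicCompletion K) hn T with hQdef
    have hQ2 := Wd.zsmul_localZSMulRoot (v.adicCompletion K) hn T
    have hQfix := Wd.zsmul_mem_fixedPoints_of_eq (v.adicCompletion K) hQ2
    have hκ : Wd.localKummerMap (v.adicCompletion K) hn T =
        Wd.localKummerClass ((2 : ℕ) : ℤ) hn Q hQfix := rfl
    rw [hκ, localKummerClass, galoisCohomology.map_one_oneCocycleClass] at hcW
    have hI : ∀ τ ∈ absInertia (v.adicCompletion K), ∀ w : geomTorsion W ((2 : ℕ) : ℤ),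
        GaloisRep.restrictField (v.adicCompletion K) (W.torsionGaloisModule ((2 : ℕ) : ℤ)) τ w = w :=
      fun τ hτ w ↦ AcSelmer.restrictField_torsionGaloisModule_apply_of_mem_absInertia W 2 1 h2v hv hτ w
    have hzero := (LocBridge.mem_unramifiedSubgroup_one_iff_forall_eq_zero _ hI _).mp hcW τ₀ hτ₀I
    have hcoc : (Wd.localKummerCocycle ((2 : ℕ) : ℤ) hn Q hQfix).1 τ₀ = 0 := by
      apply ψ.injective
      rw [map_zero]
      exact hzero
    have hτQ : τ₀ • Q = Q := by
      have h := Wd.pointsMap_localKummerCocycle_apply ((2 : ℕ) : ℤ) hn Q hQfix τ₀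
      rw [hcoc, ZeroMemClass.coe_zero, map_zero] at h
      exact (sub_eq_zero.mp h.symm).symm ▸ rfl
    have hR4 : ((2 ^ 2 : ℕ) : ℤ) • θ Q = 0 := by
      rw [← map_zsmul, show ((2 ^ 2 : ℕ) : ℤ) = (2 : ℤ) * ((2 : ℕ) : ℤ) by norm_num, mul_zsmul, hQ2,
        ← map_zsmul, ← map_zsmul, show ((2 : ℤ)) • T = (2 : ℕ) • T by rw [← natCast_zsmul]; norm_num, hT2,
        map_zero, map_zero, map_zero]
    have hRfix : τ₀ • θ Q = θ Q := smul_eq_self_of_mem_absInertia_of_zsmul_eq_zero W v hv h2v 2 hτ₀I hR4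
    have hRneg : θ Q = -(τ₀ • θ Q) := by rw [← hneg τ₀ hτ₀ Q, hτQ]
    rw [hRfix] at hRneg
    have h2R : (2 : ℤ) • θ Q = 0 := by
      rw [two_zsmul]; nth_rewrite 1 [hRneg]; exact neg_add_cancel _
    have h2Q : ((2 : ℕ) : ℤ) • Q = 0 := by
      apply θ.injective
      rw [map_zsmul, map_zero]
      exact_mod_cast h2R
    have hT0 : T = 0 := by
      rw [hQ2, AddEquiv.map_eq_zero_iff, map_eq_zero_iff _ (toGeomPoints_injective _)] at h2Q
      exact h2Q
    rw [hT0, map_zero, map_zero]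
    exact AddSubgroup.zero_mem _

/-! ## §77 UP and the dichotomy at a finite `T`-place for a FRAMED identification, modulo {PT, Tate χ} -/

/-- **Cor. 3.4 (i) UP with `T = {v₀}` finite for a FRAMED identification — modulo Poitou–Tate duality and Tate's χ only; NO parity fact,
NO image hypothesis.** gk2-p5's `natCard_selmerGroup_twist_eq_mul_two_of_local_of_isSquare` with its displayed square supplied by part 9's
`GenusKolyKramer.isSquare_card_selmerGroup_mul_of_frame` for the framed `φ`: `Sel₂(W)` strict at `v₀` ⟹ `#Sel₂(Wd) = #Sel₂(W)·2`.
[cite: MazurRubin2010, Thm. 2.7, Prop. 3.3, Cor. 3.4 (i)] [cite: Kramer1981, Thm. 1] [cite: MilneADT2006, I Thm. 4.10] -/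
theorem natCard_selmerGroup_twist_eq_mul_two_of_local_of_frame {d : K}
    (hPT : poitouTate_selmerStructure_duality_real K)
    (hEP : ∀ v : HeightOneSpectrum (𝓞 K), localEulerPoincareCharacteristic (v.adicCompletion K))
    (φ : (Wd.torsionGaloisModule ((2 : ℕ) : ℤ)).toContRepresentation →ⁱL
      (W.torsionGaloisModule ((2 : ℕ) : ℤ)).toContRepresentation)
    (ψ : (W.torsionGaloisModule ((2 : ℕ) : ℤ)).toContRepresentation →ⁱL
      (Wd.torsionGaloisModule ((2 : ℕ) : ℤ)).toContRepresentation)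
    (hψφ : ∀ a, ψ (φ a) = a) (hφψ : ∀ b, φ (ψ b) = b)
    (π : Fin 3 → Fin 3)
    (hπ : ∀ j, (show (Wd.torsionGaloisModule 2).toContRepresentation →ⁱL (W.torsionGaloisModule 2).toContRepresentation
      from φ) (T Wd (two_ne_zero (α := K)) j) = T W (two_ne_zero (α := K)) (π j))
    (A : K) (hA : ∀ i j, xT Wd (two_ne_zero (α := K)) i - xT Wd (two_ne_zero (α := K)) j
      = algebraMap K (AlgebraicClosure K) A * (xT W (two_ne_zero (α := K)) (π i) - xT W (two_ne_zero (α := K)) (π j)))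
    (hsplit : ∀ (E : Type) [Field E] [Algebra K E], (∃ s : E, s ^ 2 = algebraMap K E d) →
      (Wd.kummerLocalConditionAt ((2 : ℕ) : ℤ) E).map (galoisCohomology.map (φ.restrictField E) 1) =
        W.kummerLocalConditionAt ((2 : ℕ) : ℤ) E)
    (v₀ : HeightOneSpectrum (𝓞 K)) (hv₀ : ((2 : ℕ) : 𝓞 K) ∉ v₀.asIdeal)
    (hfin : ∀ v : HeightOneSpectrum (𝓞 K), v ≠ v₀ →
      (∃ s : v.adicCompletion K, s ^ 2 = algebraMap K (v.adicCompletion K) d) ∨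
      (((2 : ℕ) : 𝓞 K) ∉ v.asIdeal ∧ W.HasGoodReductionAt v ∧ Wd.HasGoodReductionAt v) ∨
      (((2 : ℕ) : 𝓞 K) ∉ v.asIdeal ∧
        Nat.card (nsmulAddMonoidHom 2 : (W.baseChange (v.adicCompletion K)).toAffine.Point →+ _).ker = 1 ∧
        Nat.card (nsmulAddMonoidHom 2 : (Wd.baseChange (v.adicCompletion K)).toAffine.Point →+ _).ker = 1))
    (hinf : ∀ w : InfinitePlace K,
      (∃ s : w.Completion, s ^ 2 = algebraMap K w.Completion d) ∨
      ((∀ x : galoisCohomology (W.localGaloisModule w.Completion) 1, x = 0) ∧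
        (∀ x : galoisCohomology (Wd.localGaloisModule w.Completion) 1, x = 0)))
    (htr : (Wd.kummerLocalConditionAt ((2 : ℕ) : ℤ) (v₀.adicCompletion K)).map
        (galoisCohomology.map (φ.restrictField (v₀.adicCompletion K)) 1) ⊓
      W.kummerLocalConditionAt ((2 : ℕ) : ℤ) (v₀.adicCompletion K) = ⊥)
    (ht : Nat.card (nsmulAddMonoidHom 2 : (W.baseChange (v₀.adicCompletion K)).toAffine.Point →+ _).ker = 2)
    (hstrict : ∀ c ∈ (W.kummerSelmerStructure ((2 : ℕ) : ℤ)).selmerGroup,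
      galoisCohomology.localization (W.torsionGaloisModule ((2 : ℕ) : ℤ)) (Sum.inr v₀) 1 c = 0) :
    Nat.card (Wd.selmerGroup ((2 : ℕ) : ℤ)) = Nat.card (W.selmerGroup ((2 : ℕ) : ℤ)) * 2 := by
  let 𝓐 : SelmerStructure (W.torsionGaloisModule ((2 : ℕ) : ℤ)) := fun v ↦
    (Wd.kummerSelmerStructure ((2 : ℕ) : ℤ) v).map (galoisCohomology.map (φ.restrictField (Place.Completion v)) 1)
  have h𝓐 : ∀ v, 𝓐 v = (Wd.kummerSelmerStructure ((2 : ℕ) : ℤ) v).map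
      (galoisCohomology.map (φ.restrictField (Place.Completion v)) 1) := fun _ ↦ rfl
  have hagree := transport_twist_agree_off_inr W Wd φ ψ hφψ hsplit 𝓐 h𝓐 v₀ hfin hinf
  -- the parity of the pair at `S = {v₀}`: Kramer's congruence for the FRAMED identification `φ` (part 9, unconditional)
  have hpar : IsSquare (Nat.card (Wd.selmerGroup ((2 : ℕ) : ℤ)) * Nat.card (W.selmerGroup ((2 : ℕ) : ℤ)) *
      ((Wd.kummerSelmerStructure ((2 : ℕ) : ℤ) (Sum.inr v₀)).map
          (galoisCohomology.map (φ.restrictField (Place.Completion (Sum.inr v₀ : Place K))) 1)).relIndex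
        (W.kummerSelmerStructure ((2 : ℕ) : ℤ) (Sum.inr v₀))) := by
    have hS : ∀ v ∉ ({(Sum.inr v₀ : Place K)} : Finset (Place K)), 𝓐 v = W.kummerSelmerStructure ((2 : ℕ) : ℤ) v :=
      fun v hv ↦ hagree v (by simpa using hv)
    have h := GenusKolyKramer.isSquare_card_selmerGroup_mul_of_frame W Wd φ (Function.LeftInverse.injective hψφ) π hπ A hA
      𝓐 h𝓐 {(Sum.inr v₀ : Place K)} hS
    rwa [Finset.prod_singleton] at h
  exact natCard_selmerGroup_twist_eq_mul_two_of_local_of_isSquare W Wd d hPT hEP φ ψ hψφ hφψ hsplit v₀ hv₀ hfin hinf htr ht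
    hstrict hpar

/-- **The dichotomy with `T = {v₀}` finite for a FRAMED identification**, modulo {PT, Tate χ}: `#Sel₂(Wd)·2 = #Sel₂(W)` (some Selmer
class of `W` non-trivial at `v₀`) or `#Sel₂(Wd) = #Sel₂(W)·2` (`Sel₂(W)` strict at `v₀`).
[cite: MazurRubin2010, Thm. 2.7, Prop. 3.3, Cor. 3.4 (i)] [cite: Kramer1981, Thm. 1] -/
theorem natCard_selmerGroup_twist_shift_of_local_of_frame {d : K}
    (hPT : poitouTate_selmerStructure_duality_real K)
    (hEP : ∀ v : HeightOneSpectrum (𝓞 K), localEulerPoincareCharacteristic (v.adicCompletion K))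
    (φ : (Wd.torsionGaloisModule ((2 : ℕ) : ℤ)).toContRepresentation →ⁱL
      (W.torsionGaloisModule ((2 : ℕ) : ℤ)).toContRepresentation)
    (ψ : (W.torsionGaloisModule ((2 : ℕ) : ℤ)).toContRepresentation →ⁱL
      (Wd.torsionGaloisModule ((2 : ℕ) : ℤ)).toContRepresentation)
    (hψφ : ∀ a, ψ (φ a) = a) (hφψ : ∀ b, φ (ψ b) = b)
    (π : Fin 3 → Fin 3)
    (hπ : ∀ j, (show (Wd.torsionGaloisModule 2).toContRepresentation →ⁱL (W.torsionGaloisModule 2).toContRepresentation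
      from φ) (T Wd (two_ne_zero (α := K)) j) = T W (two_ne_zero (α := K)) (π j))
    (A : K) (hA : ∀ i j, xT Wd (two_ne_zero (α := K)) i - xT Wd (two_ne_zero (α := K)) j
      = algebraMap K (AlgebraicClosure K) A * (xT W (two_ne_zero (α := K)) (π i) - xT W (two_ne_zero (α := K)) (π j)))
    (hsplit : ∀ (E : Type) [Field E] [Algebra K E], (∃ s : E, s ^ 2 = algebraMap K E d) →
      (Wd.kummerLocalConditionAt ((2 : ℕ) : ℤ) E).map (galoisCohomology.map (φ.restrictField E) 1) =
        W.kummerLocalConditionAt ((2 : ℕ) : ℤ) E)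
    (v₀ : HeightOneSpectrum (𝓞 K)) (hv₀ : ((2 : ℕ) : 𝓞 K) ∉ v₀.asIdeal)
    (hfin : ∀ v : HeightOneSpectrum (𝓞 K), v ≠ v₀ →
      (∃ s : v.adicCompletion K, s ^ 2 = algebraMap K (v.adicCompletion K) d) ∨
      (((2 : ℕ) : 𝓞 K) ∉ v.asIdeal ∧ W.HasGoodReductionAt v ∧ Wd.HasGoodReductionAt v) ∨
      (((2 : ℕ) : 𝓞 K) ∉ v.asIdeal ∧
        Nat.card (nsmulAddMonoidHom 2 : (W.baseChange (v.adicCompletion K)).toAffine.Point →+ _).ker = 1 ∧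
        Nat.card (nsmulAddMonoidHom 2 : (Wd.baseChange (v.adicCompletion K)).toAffine.Point →+ _).ker = 1))
    (hinf : ∀ w : InfinitePlace K,
      (∃ s : w.Completion, s ^ 2 = algebraMap K w.Completion d) ∨
      ((∀ x : galoisCohomology (W.localGaloisModule w.Completion) 1, x = 0) ∧
        (∀ x : galoisCohomology (Wd.localGaloisModule w.Completion) 1, x = 0)))
    (htr : (Wd.kummerLocalConditionAt ((2 : ℕ) : ℤ) (v₀.adicCompletion K)).map
        (galoisCohomology.map (φ.restrictField (v₀.adicCompletion K)) 1) ⊓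
      W.kummerLocalConditionAt ((2 : ℕ) : ℤ) (v₀.adicCompletion K) = ⊥)
    (ht : Nat.card (nsmulAddMonoidHom 2 : (W.baseChange (v₀.adicCompletion K)).toAffine.Point →+ _).ker = 2) :
    Nat.card (Wd.selmerGroup ((2 : ℕ) : ℤ)) * 2 = Nat.card (W.selmerGroup ((2 : ℕ) : ℤ)) ∨
      Nat.card (Wd.selmerGroup ((2 : ℕ) : ℤ)) = Nat.card (W.selmerGroup ((2 : ℕ) : ℤ)) * 2 := by
  by_cases hstrict : ∀ c ∈ (W.kummerSelmerStructure ((2 : ℕ) : ℤ)).selmerGroup,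
      galoisCohomology.localization (W.torsionGaloisModule ((2 : ℕ) : ℤ)) (Sum.inr v₀) 1 c = 0
  · exact Or.inr (natCard_selmerGroup_twist_eq_mul_two_of_local_of_frame W Wd hPT hEP φ ψ hψφ hφψ π hπ A hA hsplit v₀ hv₀
      hfin hinf htr ht hstrict)
  · push Not at hstrict
    obtain ⟨c, hc, hne⟩ := hstrict
    exact Or.inl (natCard_selmerGroup_twist_mul_two_eq_of_local W Wd d hPT hEP φ ψ hψφ hφψ hsplit v₀ hv₀ hfin hinf htr ht
      ⟨c, hc, hne⟩)

/-! ## §78 The dichotomy at a ramified good odd `T`-place — unconditional -/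

/-- **Cor. 3.4 (i) with `T = {v₀}` finite — UNCONDITIONAL kernel theorem, every number field, every elliptic `W`.** `Wd = C • W^{(d)}`,
`v₀ ∤ 2` a place of good reduction for `W` that is RAMIFIED in `K(√d)` (`ι(√d) ∉ K_{v₀}^{nr}`) with `#W(K_{v₀})[2] = 2`, every other finite
place on the menu {split | odd & good for both | odd & silent for both}, every infinite place on {split | `H¹ = 0` for both}: then
`#Sel₂(Wd)·2 = #Sel₂(W)` or `#Sel₂(Wd) = #Sel₂(W)·2`. PT, Tate χ and Kramer's congruence (for the framed canonical identification of §76)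
are fed by tree theorems; no Galois-image hypothesis, no «`d` non-square in `K`».
[cite: MazurRubin2010, Thm. 2.7, Lemmas 2.10–2.11, Prop. 3.3, Cor. 3.4 (i)] [cite: Kramer1981, Thm. 1, Prop. 7] [cite: MilneADT2006, I Thm. 2.8, 4.10] -/
theorem natCard_selmerGroup_twist_shift_of_local_frame {d : K} (hd : d ≠ 0) {C : VariableChange K}
    (hWd : C • W.quadraticTwist d = Wd)
    (v₀ : HeightOneSpectrum (𝓞 K)) (hv₀ : ((2 : ℕ) : 𝓞 K) ∉ v₀.asIdeal) (hv₀W : W.HasGoodReductionAt v₀)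
    (hram : closureEmb (K := K) (v₀.adicCompletion K) (geomSqrt d) ∉ maxUnramified (v₀.adicCompletion K))
    (hfin : ∀ v : HeightOneSpectrum (𝓞 K), v ≠ v₀ →
      (∃ s : v.adicCompletion K, s ^ 2 = algebraMap K (v.adicCompletion K) d) ∨
      (((2 : ℕ) : 𝓞 K) ∉ v.asIdeal ∧ W.HasGoodReductionAt v ∧ Wd.HasGoodReductionAt v) ∨
      (((2 : ℕ) : 𝓞 K) ∉ v.asIdeal ∧
        Nat.card (nsmulAddMonoidHom 2 : (W.baseChange (v.adicCompletion K)).toAffine.Point →+ _).ker = 1 ∧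
        Nat.card (nsmulAddMonoidHom 2 : (Wd.baseChange (v.adicCompletion K)).toAffine.Point →+ _).ker = 1))
    (hinf : ∀ w : InfinitePlace K,
      (∃ s : w.Completion, s ^ 2 = algebraMap K w.Completion d) ∨
      ((∀ x : galoisCohomology (W.localGaloisModule w.Completion) 1, x = 0) ∧
        (∀ x : galoisCohomology (Wd.localGaloisModule w.Completion) 1, x = 0)))
    (ht : Nat.card (nsmulAddMonoidHom 2 : (W.baseChange (v₀.adicCompletion K)).toAffine.Point →+ _).ker = 2) :
    Nat.card (Wd.selmerGroup ((2 : ℕ) : ℤ)) * 2 = Nat.card (W.selmerGroup ((2 : ℕ) : ℤ)) ∨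
      Nat.card (Wd.selmerGroup ((2 : ℕ) : ℤ)) = Nat.card (W.selmerGroup ((2 : ℕ) : ℤ)) * 2 := by
  have hEP : ∀ v : HeightOneSpectrum (𝓞 K), localEulerPoincareCharacteristic (v.adicCompletion K) := fun v ↦
    haveI : CharZero (v.adicCompletion K) := charZero_of_injective_algebraMap (algebraMap K _).injective
    localEulerPoincareCharacteristic_holds (v.adicCompletion K)
  obtain ⟨φ, ψ, hψφ, hφψ, hsplit, htr, π, A, hπ, hA⟩ := exists_intertwining_hsplit_and_transverse_frame W Wd hd hWd
  exact natCard_selmerGroup_twist_shift_of_local_of_frame W Wd (poitouTate_selmerStructure_duality_real_holds (K := K)) hEP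
    φ ψ hψφ hφψ π hπ A hA hsplit v₀ hv₀ hfin hinf (htr v₀ hv₀W hv₀ hram) ht

end Summit.BirchSwinnertonDyer.BirchSwinnertonDyer.Theorems.GenusKolyTwistLocal

end
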